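import Literature.NumberTheory.Automorphic.UnitaryGroupTruncatedKernelClassHighCuspTwo
import Literature.NumberTheory.Automorphic.UnitaryGroupTruncatedKernelClassCellBound
import Literature.NumberTheory.Automorphic.UnitaryGroupTruncatedKernelOscillation
import HarnessLib

/-!
# The cell bound and the oscillation estimate for the `𝔬`-parts `k^T_𝔬` of Arthur's truncated
# kernel on `U(2)` — the `N = 2` twin of ★ `UnitaryGroupTruncatedKernelClassCellBound`
(Rogawski, *Automorphic Representations of Unitary Groups in Three Variables* (1990), §2.2 p. 13,
with «`G = U(3)`, `U(2)`, or `U(2) × U(1)`», p. 98; Gelbart, *Automorphic forms on adele groups*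
(1975), §9.B; after Arthur, Duke Math. J. 45 (1978), §7, Thm. 7.1, stated and proved CLASS BY CLASS)

Topic `NumberTheory/Automorphic`; namespace `Literature.NumberTheory.Automorphic.UnitaryGroup`.
Proof file: THEOREMS ONLY over accepted tree modules (no definition, no named fact, no instance, no
notation, no `sorry`). H-side copy of LAWS 1–5 for `H = U(Φ₂) × U(Φ₁)` (hodgecm-mathlib, F0P3a LEAD
WORD #123∕#124; census `CENSUS-LAWS-Hside` §3 LAW 1; desk TABLE #1 row (H-L1-cusp), NEXT-3 item (R1)).
Setting as in ★ `UnitaryGroupTruncatedKernelClassHighCuspTwo`: the quasi-split unitary group `U(J₂)`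
(★ `quasiSplit F E c 2`), `N(𝔸_F) =` ★ `adelicUnipotent F E c 2` (ABELIAN — the trace-zero line),
`B(F) =` ★ `arithmeticBorel F E c 2`, `H =` ★ `borelHeight`; an ABSTRACT class map `cl : G(F) → ι`
with Rogawski's two partition axioms ★ `IsConjInvariant cl`, ★ `IsUnipotentInvariantOnBorel F E c 2 cl`
(every `N`); the class truncated kernel ★ `truncatedKernelClass` (`k^T_𝔬`).

THE POINT. [Rogawski1990, §2.2 p. 13]: «`k^T_𝔬` is integrable over `𝐙G\𝐆`» (Arthur (1978), Thm. 7.1,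
class by class). High in the cusp `k^T_𝔬(g)` is the average over a fundamental domain `𝓕` of `N(F)`
of the finitely many differences `f(g⁻¹βg) − f(g⁻¹βug)`, `β ∈ R(g) ∩ 𝔬̲`
(★ `truncatedKernelClass_eq_smul_setIntegral_finsetSum_sub_two`), so a uniform oscillation bound
`‖f(x) − f(x · g⁻¹ u g)‖ ≤ ε(g)` over the conjugate `g⁻¹ 𝓕 g` gives **`‖k^T_𝔬(g)‖ ≤ #R(g) · ε(g)`**
with the finite set `R(g) ⊆ B(F)` of ★ `finite_setOf_exists_conj_mem_of_isCompact` (every `N`).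
At `N = 2` the unipotent radical is one-dimensional over `𝔸_E⁻`, so the geometry of `Ad(g⁻¹)` on
`N(𝔸_F)` is a ONE-FACTOR normal form `g⁻¹ u g = (exp (tX), 1) · w` (census §3 LAW 1: «one-factor
normal form» replacing the three-factor normal form of the Heisenberg group ★
`UnitaryGroupHeisenbergConjThreeFactorHead`), and `ε(g) = L · ρ(g)` (§0, the `N = 2` twin of the
`U(J₃)`-typed ★ `forall_norm_sub_conj_le_of_oneFactor`, rank-free engine ★ `norm_sub_le_of_expGL`).
The proofs of §§1–2 are those of the `N = 3` file verbatim; names suffixed `_two`.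

* §0 `forall_norm_sub_conj_le_of_oneFactor_two` — the oscillation of `f` over `g⁻¹ Ω g` from the
  one-factor normal form: `‖f x − f (x · g⁻¹ u g)‖ ≤ L · ρ`.
* §1 the class cell bound **`‖k^T_𝔬(g)‖ ≤ #R · ε`** (`norm_truncatedKernelClass_le_card_mul_two`,
  `…_of_forall_conj_two`).
* §2 the packaged form `exists_finset_truncatedKernelClass_two` (same `R(g)` as the classless ★
  `exists_finset_truncatedKernel`, every class).
* §3 the class oscillation estimate **`‖k^T_𝔬(g)‖ ≤ #R(g) · Lρ(g)`** from the one-factor normal form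
  (`norm_truncatedKernelClass_le_card_mul_of_oneFactor_two`,
  `exists_finset_norm_truncatedKernelClass_le_of_oneFactor_two`).
* §4 for a TEST function (★ `IsQuasiSplitTest F E c 2`):
  **`IsQuasiSplitTest.exists_level_norm_truncatedKernelClass_le_two`** — the level
  `U' ∈ finiteLevelsGL 2 E` and the Lipschitz constant `L` of ★ `IsQuasiSplitTest.exists_lift_level_lipschitz`
  (every `N`) serve EVERY class map and class; only the one-factor geometry of `g⁻¹ 𝓕 g` is left open
  (it is supplied on the Borel Siegel set of `U(J₂)` by the structure row ★ `UnitaryGroupBorelSiegelSetStructureTwo`).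

HC_CM is proved only modulo the 7 printed citations until rung 0 closes.

## References

* J. D. Rogawski, *Automorphic Representations of Unitary Groups in Three Variables*, Ann. of
  Math. Studies 123 (1990), §2.2 (pp. 12–14: `K_{P,𝔬}`, `k^T_𝔬`, «`k^T_𝔬` is integrable»), §7.3 (p. 98)
  [Rogawski1990].
* S. Gelbart, *Automorphic forms on adele groups*, Ann. of Math. Studies 83 (1975), §9.B,
  (9.44)–(9.46) [Gelbart1975].
* J. Arthur, *A trace formula for reductive groups I*, Duke Math. J. 45 (1978), §7, Thm. 7.1 — cited
  through the held expositions above.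
-/

set_option autoImplicit false

noncomputable section

open MeasureTheory Measure NumberField NumberField.mixedEmbedding IsDedekindDomain Set
-- `open scoped Classical` is needed to see the Mathlib (normed ring) instances on `mixedSpace E` (note H5 of
-- `AdelicGLnGlue`), as in ★ `UnitaryGroupTruncatedKernelOscillation`
open scoped NNReal ENNReal Pointwise MatrixGroups Classical

namespace Literature.NumberTheory.Automorphic

namespace UnitaryGroup

variable {F E : Type} [Field F] [NumberField F] [Field E] [NumberField E] [Algebra F E]
  {c : E ≃ₐ[F] E} {ι : Type*}

/-! ## §0 The oscillation of `f` over `g⁻¹ Ω g` from the one-factor normal form (`N = 2`) -/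

/-- **THE OSCILLATION BOUND FROM THE ONE-FACTOR NORMAL FORM** (`U(J₂)`, commutative unipotent
radical): if `f = φ ∘ adelicVal` with `φ` right invariant under `U ≤ GL₂(𝔸_E)` and `L`-Lipschitz along
the archimedean one-parameter elements `(exp (tX), 1)`, `X ∈ S`, and every conjugate `g⁻¹ u g`,
`u ∈ Ω`, reads `(exp (tX), 1) · w` with `X ∈ S`, `|t| ≤ ρ`, `w ∈ U`, then
`‖f x − f (x · g⁻¹ u g)‖ ≤ L · ρ` for all `x` and all `u ∈ Ω` (the `N = 2` twin of the `U(J₃)`-typed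
★ `forall_norm_sub_conj_le_of_oneFactor`; engine ★ `norm_sub_le_of_expGL`, every rank).
[cite: Rogawski1990, §2.2 (p. 13)] -/
theorem forall_norm_sub_conj_le_of_oneFactor_two {V : Type*} [SeminormedAddCommGroup V]
    {f : (quasiSplit F E c 2).Adelic → V} {φ : GL (Fin 2) (AdeleRing (𝓞 E) E) → V}
    (hφ : ∀ y, f y = φ (adelicVal F E c 2 _ y))
    {U : Subgroup (GL (Fin 2) (AdeleRing (𝓞 E) E))} (hU : ∀ u ∈ U, ∀ z, φ (z * u) = φ z)
    {S : Set (Matrix (Fin 2) (Fin 2) (mixedSpace E))} {L : ℝ} (hL0 : 0 ≤ L)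
    (hL : ∀ z, ∀ X ∈ S, ∀ t : ℝ, ‖φ (z * GLn.ofInfinite 2 E (expGL (t • X))) - φ z‖ ≤ L * |t|)
    {g : (quasiSplit F E c 2).Adelic} {ρ : ℝ} {Ω : Set (adelicUnipotent F E c 2)}
    (hgeom : ∀ u ∈ Ω, ∃ (t : ℝ) (X : Matrix (Fin 2) (Fin 2) (mixedSpace E))
        (w : GL (Fin 2) (AdeleRing (𝓞 E) E)), X ∈ S ∧ w ∈ U ∧ |t| ≤ ρ ∧
      adelicVal F E c 2 _ (g⁻¹ * (u : (quasiSplit F E c 2).Adelic) * g) =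
        GLn.ofInfinite 2 E (expGL (t • X)) * w) :
    ∀ x : (quasiSplit F E c 2).Adelic, ∀ u ∈ Ω,
      ‖f x - f (x * (g⁻¹ * (u : (quasiSplit F E c 2).Adelic) * g))‖ ≤ L * ρ := by
  intro x u hu
  obtain ⟨t, X, w, hX, hw, ht, hval⟩ := hgeom u hu
  rw [hφ, hφ, map_mul, hval, norm_sub_rev]
  exact norm_sub_le_of_expGL φ hU hL0 hL ht hX hw _


section Two

variable [MeasurableSpace (adelicUnipotent F E c 2)] [BorelSpace (adelicUnipotent F E c 2)]

/-! ## §1 The class cell bound -/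

/-- **THE CLASS CELL BOUND `‖k^T_𝔬(g)‖ ≤ #R · ε`**: if every relevant term oscillates by at most `ε` over
the cells, `‖f(g⁻¹ β g) − f(g⁻¹ β u g)‖ ≤ ε` for `β ∈ R`, `u ∈ 𝓕`, then `‖k^T_𝔬(g)‖ ≤ #R · ε` (same
hypotheses as the identity ★ `truncatedKernelClass_eq_smul_setIntegral_finsetSum_sub_two`; the class cuts
the sum down by an indicator, which only decreases norms). The per-`𝔬` form of
★ `norm_truncatedKernel_le_card_mul`. [cite: Rogawski1990, §2.2 (p. 13)] -/
theorem norm_truncatedKernelClass_le_card_mul_two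
    {cl : (quasiSplit F E c 2).arithmeticSubgroup → ι} (hcl : IsConjInvariant cl)
    (hclN : IsUnipotentInvariantOnBorel F E c 2 cl) (ν : Measure (adelicUnipotent F E c 2))
    [ν.IsHaarMeasure] {𝓕 U : Set (adelicUnipotent F E c 2)}
    (h𝓕 : IsFundamentalDomain (rationalUnipotent F E c 2) 𝓕 ν) (hU : IsCompact U) (h𝓕U : 𝓕 ⊆ U) (i : ι)
    {f : (quasiSplit F E c 2).Adelic → ℂ} (hfc : Continuous f) (hf : HasCompactSupport f)
    {T : ℝ≥0} (hT : 1 ≤ T) {g : (quasiSplit F E c 2).Adelic} (hg : T < borelHeight g)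
    (hK : kernelClass cl i f g g = borelSumClass cl i f g g) (R : Finset (arithmeticBorel F E c 2))
    (hR₁ : ∀ β ∉ R,
      f (g⁻¹ * (((β : (quasiSplit F E c 2).arithmeticSubgroup)) : (quasiSplit F E c 2).Adelic) * g) = 0)
    (hR₂ : ∀ β ∉ R, ∀ u ∈ 𝓕,
      f (g⁻¹ * (((β : (quasiSplit F E c 2).arithmeticSubgroup)) : (quasiSplit F E c 2).Adelic) *
        ((u : (quasiSplit F E c 2).Adelic) * g)) = 0)
    {ε : ℝ} (hosc : ∀ β ∈ R, ∀ u ∈ 𝓕,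
      ‖f (g⁻¹ * (((β : (quasiSplit F E c 2).arithmeticSubgroup)) : (quasiSplit F E c 2).Adelic) * g) -
        f (g⁻¹ * (((β : (quasiSplit F E c 2).arithmeticSubgroup)) : (quasiSplit F E c 2).Adelic) *
          ((u : (quasiSplit F E c 2).Adelic) * g))‖ ≤ ε) :
    ‖truncatedKernelClass ν 𝓕 T cl i f g‖ ≤ R.card * ε := by
  have h0 : ν 𝓕 ≠ 0 := measure_ne_zero_of_isFundamentalDomain ν h𝓕
  have htop : ν 𝓕 ≠ ∞ := ((measure_mono h𝓕U).trans_lt hU.measure_lt_top).ne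
  have hpos : 0 < (ν 𝓕).toReal := ENNReal.toReal_pos h0 htop
  rw [truncatedKernelClass_eq_smul_setIntegral_finsetSum_sub_two hcl hclN ν h𝓕 hU h𝓕U i hfc hf hT hg hK R
      hR₁ hR₂, _root_.norm_smul, norm_inv, Real.norm_eq_abs, abs_of_pos hpos]
  have hbound : ∀ u ∈ 𝓕, ‖∑ β ∈ R,
        ((fun β : arithmeticBorel F E c 2 => cl β) ⁻¹' {i}).indicator
          (fun β : arithmeticBorel F E c 2 =>
            f (g⁻¹ * (((β : (quasiSplit F E c 2).arithmeticSubgroup)) : (quasiSplit F E c 2).Adelic) * g) -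
            f (g⁻¹ * (((β : (quasiSplit F E c 2).arithmeticSubgroup)) : (quasiSplit F E c 2).Adelic) *
              ((u : (quasiSplit F E c 2).Adelic) * g))) β‖ ≤ R.card * ε := by
    intro u hu
    calc _ ≤ ∑ β ∈ R,
          ‖((fun β : arithmeticBorel F E c 2 => cl β) ⁻¹' {i}).indicator
          (fun β : arithmeticBorel F E c 2 =>
            f (g⁻¹ * (((β : (quasiSplit F E c 2).arithmeticSubgroup)) : (quasiSplit F E c 2).Adelic) * g) -
            f (g⁻¹ * (((β : (quasiSplit F E c 2).arithmeticSubgroup)) : (quasiSplit F E c 2).Adelic) *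
              ((u : (quasiSplit F E c 2).Adelic) * g))) β‖ := norm_sum_le _ _
      _ ≤ ∑ β ∈ R, ε := Finset.sum_le_sum fun β hβ =>
          (norm_indicator_le_norm_self _ _).trans (hosc β hβ u hu)
      _ = R.card * ε := by rw [Finset.sum_const, nsmul_eq_mul]
  calc (ν 𝓕).toReal⁻¹ * ‖∫ u in 𝓕, (∑ β ∈ R,
        ((fun β : arithmeticBorel F E c 2 => cl β) ⁻¹' {i}).indicator
          (fun β : arithmeticBorel F E c 2 =>
            f (g⁻¹ * (((β : (quasiSplit F E c 2).arithmeticSubgroup)) : (quasiSplit F E c 2).Adelic) * g) -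
            f (g⁻¹ * (((β : (quasiSplit F E c 2).arithmeticSubgroup)) : (quasiSplit F E c 2).Adelic) *
              ((u : (quasiSplit F E c 2).Adelic) * g))) β) ∂ν‖
      ≤ (ν 𝓕).toReal⁻¹ * ((R.card * ε) * (ν 𝓕).toReal) := by
        refine mul_le_mul_of_nonneg_left ?_ (inv_nonneg.2 hpos.le)
        have h := norm_setIntegral_le_of_norm_le_const htop.lt_top hbound
        rwa [measureReal_def] at h
    _ = R.card * ε := by field_simp

/-- **THE CLASS CELL BOUND, right-translation form**: since `g⁻¹ β u g = (g⁻¹ β g)(g⁻¹ u g)`, a uniform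
bound `‖f(x) − f(x · g⁻¹ u g)‖ ≤ ε` (`x ∈ G(𝔸_F)`, `u ∈ 𝓕`) — the right modulus of continuity of `f` on
the conjugate `g⁻¹ 𝓕 g` of the fundamental domain, SMALL high in the cusp — gives `‖k^T_𝔬(g)‖ ≤ #R · ε`.
The per-`𝔬` form of ★ `norm_truncatedKernel_le_card_mul_of_forall_conj`. [cite: Rogawski1990, §2.2 (p. 13)] -/
theorem norm_truncatedKernelClass_le_card_mul_of_forall_conj_two
    {cl : (quasiSplit F E c 2).arithmeticSubgroup → ι} (hcl : IsConjInvariant cl)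
    (hclN : IsUnipotentInvariantOnBorel F E c 2 cl) (ν : Measure (adelicUnipotent F E c 2))
    [ν.IsHaarMeasure] {𝓕 U : Set (adelicUnipotent F E c 2)}
    (h𝓕 : IsFundamentalDomain (rationalUnipotent F E c 2) 𝓕 ν) (hU : IsCompact U) (h𝓕U : 𝓕 ⊆ U) (i : ι)
    {f : (quasiSplit F E c 2).Adelic → ℂ} (hfc : Continuous f) (hf : HasCompactSupport f)
    {T : ℝ≥0} (hT : 1 ≤ T) {g : (quasiSplit F E c 2).Adelic} (hg : T < borelHeight g)
    (hK : kernelClass cl i f g g = borelSumClass cl i f g g) (R : Finset (arithmeticBorel F E c 2))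
    (hR₁ : ∀ β ∉ R,
      f (g⁻¹ * (((β : (quasiSplit F E c 2).arithmeticSubgroup)) : (quasiSplit F E c 2).Adelic) * g) = 0)
    (hR₂ : ∀ β ∉ R, ∀ u ∈ 𝓕,
      f (g⁻¹ * (((β : (quasiSplit F E c 2).arithmeticSubgroup)) : (quasiSplit F E c 2).Adelic) *
        ((u : (quasiSplit F E c 2).Adelic) * g)) = 0)
    {ε : ℝ} (hω : ∀ x : (quasiSplit F E c 2).Adelic, ∀ u ∈ 𝓕,
      ‖f x - f (x * (g⁻¹ * (u : (quasiSplit F E c 2).Adelic) * g))‖ ≤ ε) :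
    ‖truncatedKernelClass ν 𝓕 T cl i f g‖ ≤ R.card * ε := by
  refine norm_truncatedKernelClass_le_card_mul_two hcl hclN ν h𝓕 hU h𝓕U i hfc hf hT hg hK R hR₁ hR₂
    fun β _ u hu => ?_
  have hmul : g⁻¹ * (((β : (quasiSplit F E c 2).arithmeticSubgroup)) : (quasiSplit F E c 2).Adelic) *
      ((u : (quasiSplit F E c 2).Adelic) * g) =
      g⁻¹ * (((β : (quasiSplit F E c 2).arithmeticSubgroup)) : (quasiSplit F E c 2).Adelic) * g *
        (g⁻¹ * (u : (quasiSplit F E c 2).Adelic) * g) := by group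
  rw [hmul]
  exact hω _ u hu

/-! ## §2 The packaged form -/

/-- **THE PACKAGED CLASS CELL BOUND.** For a Haar measure `ν` on `N(𝔸_F)`, a fundamental domain `𝓕` of
`N(F)` inside a compact `U`, `f ∈ C_c(U(J₂)(𝔸_F))`, a class map with Rogawski's two axioms, a class `𝔬`,
`1 ≤ T`, and `g` with `T < H(g)` and `K_𝔬(g, g) = Σ_{β ∈ B(F)∩𝔬̲} f(g⁻¹βg)`: the set `R(g)` of `β ∈ B(F)`
with `g⁻¹ β (y g) ∈ supp f` for some `y ∈ {1} ∪ U` (the SAME set as in ★ `exists_finset_truncatedKernel`,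
for every class) is finite, `k^T_𝔬(g) = ν(𝓕)⁻¹ ∫_𝓕 Σ_{β ∈ R(g) ∩ 𝔬̲} [f(g⁻¹βg) − f(g⁻¹βug)] dν(u)`, and
`‖k^T_𝔬(g)‖ ≤ #R(g) · ε` whenever `‖f(x) − f(x · g⁻¹ug)‖ ≤ ε` for all `x` and `u ∈ 𝓕`.
[cite: Rogawski1990, §2.2 (p. 13)] -/
theorem exists_finset_truncatedKernelClass_two
    {cl : (quasiSplit F E c 2).arithmeticSubgroup → ι} (hcl : IsConjInvariant cl)
    (hclN : IsUnipotentInvariantOnBorel F E c 2 cl) (ν : Measure (adelicUnipotent F E c 2))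
    [ν.IsHaarMeasure] {𝓕 U : Set (adelicUnipotent F E c 2)}
    (h𝓕 : IsFundamentalDomain (rationalUnipotent F E c 2) 𝓕 ν) (hU : IsCompact U) (h𝓕U : 𝓕 ⊆ U) (i : ι)
    {f : (quasiSplit F E c 2).Adelic → ℂ} (hfc : Continuous f) (hf : HasCompactSupport f)
    {T : ℝ≥0} (hT : 1 ≤ T) {g : (quasiSplit F E c 2).Adelic} (hg : T < borelHeight g)
    (hK : kernelClass cl i f g g = borelSumClass cl i f g g) :
    ∃ R : Finset (arithmeticBorel F E c 2),
      (∀ β ∈ R, ∃ y ∈ insert (1 : (quasiSplit F E c 2).Adelic)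
          ((fun u : adelicUnipotent F E c 2 => (u : (quasiSplit F E c 2).Adelic)) '' U),
        g⁻¹ * (((β : (quasiSplit F E c 2).arithmeticSubgroup)) : (quasiSplit F E c 2).Adelic) * (y * g)
          ∈ tsupport f) ∧
      truncatedKernelClass ν 𝓕 T cl i f g = ((ν 𝓕).toReal⁻¹ : ℝ) • ∫ u in 𝓕, (∑ β ∈ R,
        ((fun β : arithmeticBorel F E c 2 => cl β) ⁻¹' {i}).indicator
          (fun β : arithmeticBorel F E c 2 =>
            f (g⁻¹ * (((β : (quasiSplit F E c 2).arithmeticSubgroup)) : (quasiSplit F E c 2).Adelic) * g) -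
            f (g⁻¹ * (((β : (quasiSplit F E c 2).arithmeticSubgroup)) : (quasiSplit F E c 2).Adelic) *
              ((u : (quasiSplit F E c 2).Adelic) * g))) β) ∂ν ∧
      ∀ ε : ℝ, (∀ x : (quasiSplit F E c 2).Adelic, ∀ u ∈ 𝓕,
        ‖f x - f (x * (g⁻¹ * (u : (quasiSplit F E c 2).Adelic) * g))‖ ≤ ε) →
        ‖truncatedKernelClass ν 𝓕 T cl i f g‖ ≤ R.card * ε := by
  -- the compact set of right factors `Y = {1} ∪ U` and the finite set for `C = tsupport f`
  set Y : Set (quasiSplit F E c 2).Adelic := insert (1 : (quasiSplit F E c 2).Adelic)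
    ((fun u : adelicUnipotent F E c 2 => (u : (quasiSplit F E c 2).Adelic)) '' U) with hY
  have hYc : IsCompact Y := (hU.image continuous_subtype_val).insert 1
  have hfin := finite_setOf_exists_conj_mem_of_isCompact hf hYc g
  have hR₁ : ∀ β ∉ hfin.toFinset,
      f (g⁻¹ * (((β : (quasiSplit F E c 2).arithmeticSubgroup)) : (quasiSplit F E c 2).Adelic) * g) = 0 := by
    intro β hβ
    by_contra h
    exact hβ (hfin.mem_toFinset.2 ⟨1, mem_insert _ _, by
      rw [one_mul]; exact subset_tsupport _ (Function.mem_support.2 h)⟩)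
  have hR₂ : ∀ β ∉ hfin.toFinset, ∀ u ∈ 𝓕,
      f (g⁻¹ * (((β : (quasiSplit F E c 2).arithmeticSubgroup)) : (quasiSplit F E c 2).Adelic) *
        ((u : (quasiSplit F E c 2).Adelic) * g)) = 0 := by
    intro β hβ u hu
    by_contra h
    exact hβ (hfin.mem_toFinset.2 ⟨(u : (quasiSplit F E c 2).Adelic),
      mem_insert_of_mem _ ⟨u, h𝓕U hu, rfl⟩, subset_tsupport _ (Function.mem_support.2 h)⟩)
  exact ⟨hfin.toFinset, fun β hβ => hfin.mem_toFinset.1 hβ,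
    truncatedKernelClass_eq_smul_setIntegral_finsetSum_sub_two hcl hclN ν h𝓕 hU h𝓕U i hfc hf hT hg hK _
      hR₁ hR₂,
    fun ε hω => norm_truncatedKernelClass_le_card_mul_of_forall_conj_two hcl hclN ν h𝓕 hU h𝓕U i hfc hf hT
      hg hK _ hR₁ hR₂ hω⟩

/-! ## §3 The class oscillation estimate from the one-factor normal form -/

/-- **THE CLASS TRUNCATED KERNEL IS SMALL HIGH IN THE CUSP, `R`-explicit form** (`U(J₂)`): under the
hypotheses of the class cell bound (§1) and the ONE-factor normal form of `g⁻¹ 𝓕 g` (§0: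
`f = φ ∘ adelicVal` with `φ` right invariant under a level `U' ≤ GL₂(𝔸_E)` and `L`-Lipschitz along the
archimedean one-parameter elements `(exp (tX), 1)`, `X ∈ S`; every conjugate `g⁻¹ u g`, `u ∈ 𝓕`, reads
`(exp (tX), 1) · w` with `X ∈ S`, `|t| ≤ ρ`, `w ∈ U'`), `‖k^T_𝔬(g)‖ ≤ #R · (L · ρ)` — the `N = 2`,
per-`𝔬` form of ★ `norm_truncatedKernel_le_card_mul_of_threeFactor`. [cite: Rogawski1990, §2.2 (p. 13)] -/
theorem norm_truncatedKernelClass_le_card_mul_of_oneFactor_two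
    {cl : (quasiSplit F E c 2).arithmeticSubgroup → ι} (hcl : IsConjInvariant cl)
    (hclN : IsUnipotentInvariantOnBorel F E c 2 cl) (ν : Measure (adelicUnipotent F E c 2))
    [ν.IsHaarMeasure] {𝓕 U : Set (adelicUnipotent F E c 2)}
    (h𝓕 : IsFundamentalDomain (rationalUnipotent F E c 2) 𝓕 ν) (hU : IsCompact U) (h𝓕U : 𝓕 ⊆ U) (i : ι)
    {f : (quasiSplit F E c 2).Adelic → ℂ} (hfc : Continuous f) (hf : HasCompactSupport f)
    {T : ℝ≥0} (hT : 1 ≤ T) {g : (quasiSplit F E c 2).Adelic} (hg : T < borelHeight g)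
    (hK : kernelClass cl i f g g = borelSumClass cl i f g g) (R : Finset (arithmeticBorel F E c 2))
    (hR₁ : ∀ β ∉ R,
      f (g⁻¹ * (((β : (quasiSplit F E c 2).arithmeticSubgroup)) : (quasiSplit F E c 2).Adelic) * g) = 0)
    (hR₂ : ∀ β ∉ R, ∀ u ∈ 𝓕,
      f (g⁻¹ * (((β : (quasiSplit F E c 2).arithmeticSubgroup)) : (quasiSplit F E c 2).Adelic) *
        ((u : (quasiSplit F E c 2).Adelic) * g)) = 0)
    {φ : GL (Fin 2) (AdeleRing (𝓞 E) E) → ℂ} (hφ : ∀ y, f y = φ (adelicVal F E c 2 _ y))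
    {U' : Subgroup (GL (Fin 2) (AdeleRing (𝓞 E) E))} (hU' : ∀ u ∈ U', ∀ z, φ (z * u) = φ z)
    {S : Set (Matrix (Fin 2) (Fin 2) (mixedSpace E))} {L : ℝ} (hL0 : 0 ≤ L)
    (hL : ∀ z, ∀ X ∈ S, ∀ t : ℝ, ‖φ (z * GLn.ofInfinite 2 E (expGL (t • X))) - φ z‖ ≤ L * |t|)
    {ρ : ℝ}
    (hgeom : ∀ u ∈ 𝓕, ∃ (t : ℝ) (X : Matrix (Fin 2) (Fin 2) (mixedSpace E))
        (w : GL (Fin 2) (AdeleRing (𝓞 E) E)), X ∈ S ∧ w ∈ U' ∧ |t| ≤ ρ ∧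
      adelicVal F E c 2 _ (g⁻¹ * (u : (quasiSplit F E c 2).Adelic) * g) =
        GLn.ofInfinite 2 E (expGL (t • X)) * w) :
    ‖truncatedKernelClass ν 𝓕 T cl i f g‖ ≤ R.card * (L * ρ) :=
  norm_truncatedKernelClass_le_card_mul_of_forall_conj_two hcl hclN ν h𝓕 hU h𝓕U i hfc hf hT hg hK R hR₁ hR₂
    (forall_norm_sub_conj_le_of_oneFactor_two hφ hU' hL0 hL hgeom)

/-- **THE CLASS TRUNCATED KERNEL IS SMALL HIGH IN THE CUSP, packaged form** (`U(J₂)`): with `R(g)` the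
finite set of §2 (the `β ∈ B(F)` with `g⁻¹ β (y g) ∈ supp f` for some `y ∈ {1} ∪ U`, as in ★
`exists_finset_truncatedKernel`), the one-factor normal form at scale `ρ` gives
`‖k^T_𝔬(g)‖ ≤ #R(g) · (L · ρ)` — the `N = 2`, per-`𝔬` form of ★
`exists_finset_norm_truncatedKernel_le_of_threeFactor`. [cite: Rogawski1990, §2.2 (p. 13)] -/
theorem exists_finset_norm_truncatedKernelClass_le_of_oneFactor_two
    {cl : (quasiSplit F E c 2).arithmeticSubgroup → ι} (hcl : IsConjInvariant cl)
    (hclN : IsUnipotentInvariantOnBorel F E c 2 cl) (ν : Measure (adelicUnipotent F E c 2))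
    [ν.IsHaarMeasure] {𝓕 U : Set (adelicUnipotent F E c 2)}
    (h𝓕 : IsFundamentalDomain (rationalUnipotent F E c 2) 𝓕 ν) (hU : IsCompact U) (h𝓕U : 𝓕 ⊆ U) (i : ι)
    {f : (quasiSplit F E c 2).Adelic → ℂ} (hfc : Continuous f) (hf : HasCompactSupport f)
    {T : ℝ≥0} (hT : 1 ≤ T) {g : (quasiSplit F E c 2).Adelic} (hg : T < borelHeight g)
    (hK : kernelClass cl i f g g = borelSumClass cl i f g g)
    {φ : GL (Fin 2) (AdeleRing (𝓞 E) E) → ℂ} (hφ : ∀ y, f y = φ (adelicVal F E c 2 _ y))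
    {U' : Subgroup (GL (Fin 2) (AdeleRing (𝓞 E) E))} (hU' : ∀ u ∈ U', ∀ z, φ (z * u) = φ z)
    {S : Set (Matrix (Fin 2) (Fin 2) (mixedSpace E))} {L : ℝ} (hL0 : 0 ≤ L)
    (hL : ∀ z, ∀ X ∈ S, ∀ t : ℝ, ‖φ (z * GLn.ofInfinite 2 E (expGL (t • X))) - φ z‖ ≤ L * |t|)
    {ρ : ℝ}
    (hgeom : ∀ u ∈ 𝓕, ∃ (t : ℝ) (X : Matrix (Fin 2) (Fin 2) (mixedSpace E))
        (w : GL (Fin 2) (AdeleRing (𝓞 E) E)), X ∈ S ∧ w ∈ U' ∧ |t| ≤ ρ ∧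
      adelicVal F E c 2 _ (g⁻¹ * (u : (quasiSplit F E c 2).Adelic) * g) =
        GLn.ofInfinite 2 E (expGL (t • X)) * w) :
    ∃ R : Finset (arithmeticBorel F E c 2),
      (∀ β ∈ R, ∃ y ∈ insert (1 : (quasiSplit F E c 2).Adelic)
          ((fun u : adelicUnipotent F E c 2 => (u : (quasiSplit F E c 2).Adelic)) '' U),
        g⁻¹ * (((β : (quasiSplit F E c 2).arithmeticSubgroup)) : (quasiSplit F E c 2).Adelic) * (y * g)
          ∈ tsupport f) ∧
      ‖truncatedKernelClass ν 𝓕 T cl i f g‖ ≤ R.card * (L * ρ) := by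
  obtain ⟨R, hR, -, hbound⟩ := exists_finset_truncatedKernelClass_two hcl hclN ν h𝓕 hU h𝓕U i hfc hf hT hg hK
  exact ⟨R, hR, hbound _ (forall_norm_sub_conj_le_of_oneFactor_two hφ hU' hL0 hL hgeom)⟩

/-! ## §4 The class oscillation bound for a test function, only the geometry left open -/

/-- **THE CLASS TRUNCATED KERNEL OF A TEST FUNCTION IS SMALL HIGH IN THE CUSP, modulo the one-factor
geometry, UNIFORMLY IN THE CLASS** (`U(J₂)`): for `f ∈ C_c^∞(U(J₂)(𝔸_F))` (★ `IsQuasiSplitTest F E c 2`)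
and a compact set `S` of archimedean directions there are an admissible level `U' ∈ finiteLevelsGL 2 E`
and `L ≥ 0` — depending only on `f` and `S`, NOT on the class map or the class (they come from the lift
★ `IsQuasiSplitTest.exists_lift_level_lipschitz`, every `N`) — such that for every Haar measure `ν`,
fundamental domain `𝓕 ⊆ Uc` (compact), `1 ≤ T < H(g)`, every class map with Rogawski's two axioms and
every class `𝔬` with `K_𝔬(g, g) = Σ_{β ∈ B(F)∩𝔬̲} f(g⁻¹βg)`, the one-factor normal form of `g⁻¹ 𝓕 g` at
scale `ρ` gives `‖k^T_𝔬(g)‖ ≤ #R(g) · (L · ρ)` with the `R(g)` of §2 — the `N = 2`, per-`𝔬` form of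
★ `IsQuasiSplitTest.exists_level_norm_truncatedKernel_le`. [cite: Rogawski1990, §2.2 (p. 13)] -/
theorem IsQuasiSplitTest.exists_level_norm_truncatedKernelClass_le_two {f : (quasiSplit F E c 2).Adelic → ℂ}
    (hf : IsQuasiSplitTest F E c 2 f)
    {S : Set (Matrix (Fin 2) (Fin 2) (mixedSpace E))} (hS : IsCompact S) :
    ∃ U' ∈ finiteLevelsGL 2 E, ∃ L : ℝ, 0 ≤ L ∧
      ∀ (ν : Measure (adelicUnipotent F E c 2)) [ν.IsHaarMeasure]
        {𝓕 Uc : Set (adelicUnipotent F E c 2)},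
        IsFundamentalDomain (rationalUnipotent F E c 2) 𝓕 ν → IsCompact Uc → 𝓕 ⊆ Uc →
        ∀ {T : ℝ≥0}, 1 ≤ T → ∀ {g : (quasiSplit F E c 2).Adelic}, T < borelHeight g →
        ∀ (cl : (quasiSplit F E c 2).arithmeticSubgroup → ι), IsConjInvariant cl →
          IsUnipotentInvariantOnBorel F E c 2 cl → ∀ (i : ι),
        kernelClass cl i f g g = borelSumClass cl i f g g → ∀ (ρ : ℝ),
        (∀ u ∈ 𝓕, ∃ (t : ℝ) (X : Matrix (Fin 2) (Fin 2) (mixedSpace E))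
            (w : GL (Fin 2) (AdeleRing (𝓞 E) E)), X ∈ S ∧ w ∈ U' ∧ |t| ≤ ρ ∧
          adelicVal F E c 2 _ (g⁻¹ * (u : (quasiSplit F E c 2).Adelic) * g) =
            GLn.ofInfinite 2 E (expGL (t • X)) * w) →
        ∃ R : Finset (arithmeticBorel F E c 2),
          (∀ β ∈ R, ∃ y ∈ insert (1 : (quasiSplit F E c 2).Adelic)
              ((fun u : adelicUnipotent F E c 2 => (u : (quasiSplit F E c 2).Adelic)) '' Uc),
            g⁻¹ * (((β : (quasiSplit F E c 2).arithmeticSubgroup)) : (quasiSplit F E c 2).Adelic) *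
              (y * g) ∈ tsupport f) ∧
          ‖truncatedKernelClass ν 𝓕 T cl i f g‖ ≤ R.card * (L * ρ) := by
  obtain ⟨φ, hφ, U', hU', hinv, L, hL0, hL⟩ := hf.exists_lift_level_lipschitz hS
  exact ⟨U', hU', L, hL0, fun ν _ 𝓕 Uc h𝓕 hUc h𝓕U T hT g hg cl hcl hclN i hK ρ hgeom =>
    exists_finset_norm_truncatedKernelClass_le_of_oneFactor_two hcl hclN ν h𝓕 hUc h𝓕U i hf.continuous'
      hf.hasCompactSupport' hT hg hK hφ hinv hL0 hL hgeom⟩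

end Two

end UnitaryGroup

end Literature.NumberTheory.Automorphic

end
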